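import Summits.QuantumFields.YangMills.Theorems.BalabanUVNodesN11Sect3SupplySpliceFrame
import Summits.QuantumFields.YangMills.Theorems.BalabanUVNodesN11Sect3SupplyPresentParents
import Summits.QuantumFields.YangMills.Theorems.BalabanUVNodesN11ThmP245OfSect3SupplyCoPH

/-!
# DAG node N11 — [III] §3's SUPPLY CUT TO ITS MINIMAL FORM: `Sect3SpliceSupplyAt θ p k → Sect3SupplyAt θ p k` (generic `θ : Stage13HParams`), and Theorem 1 ∕ the (S1ᵀ) slot
# re-keyed on it; at `k = 0` the level-1 form of `ρ₁` at the re-pinned door of the cured witness of record from Thm-2-type clauses for the FIRST-STEP terms + the identity ALONE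

Cell `pub-ymgap`, YM-PLAN Track A (HUMAN RULING D-0062 ∕ D-0149), seat `pub-ymgap-dag-n11-e` (g15; R134 fan-out row N11∕s3), route `BalabanUVNodes` rev 25 (v1.7 `CoPH` key), item
K1⁷ `StabilityBAtRecordR13SepCoPH` = stmt-QuantumFields-20542 (helper lane, count-neutral).  [III] = [Balaban1988Convergent], [IV] = [Balaban1989LargeFieldI].  Over this seat's
`…Sect3SupplySpliceDefs` (`graftAbove ∕ zeroRB ∕ dropBFrom`, `Sect3SpliceSupplyAt`), `…Sect3SupplySpliceFrame` (`lawsT_towerOfTerms_crossFrame`, the zero-new-term package),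
`…Sect3SupplyDefs` (p576857), `…Sect3SupplyPresentParents` (p580585: an absent parent has an absent 𝐓-image child), `…RePinnedUnivECoPH` §0 (p575321: the new-𝐄 clauses transfer
between histories) and `…ThmP245OfSect3SupplyCoPH` (p578897).

WHY THIS FILE.  Plan g77's W-SEAT-START-LIST §n11: «the w-pieces are the Sect-3 SUPPLY items n11-e displays».  `Sect3SupplyAt θ p k` displays a whole candidate family with its
bookkeeping; what a §3 supplier has to PRODUCE is smaller, and is named `Sect3SpliceSupplyAt θ p k` (Defs): per exposed witness `(t, E_k)` of `ρ_k`, new term values `tnew`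
(universal in 𝐄) and constants `EkN`, and AT THE EXPANSION CHILDREN OF PRESENT PARENTS ONLY: (O1) the old `𝐁^{(k)}` on the child's `Ũ^c_k(X)` (LOCATED-SPACEB; void at `k = 0`),
(O2) r11's new-term obligations + analyticity at `k+1` for `tnew` = [III] Thm 2's clauses, (O3) the 𝐓-image clause for the spliced witness = [III] (3.67).  THIS FILE discharges the
rest: §1 builds, from such a supply, the `Sect3SupplyAt` family — at a no-expansion history `graftAbove k (t ∘ init) (zeroRB tnew)` (old terms, the universal new 𝐄, no new
`𝐑 ∕ 𝐁`, `E_{k+1} = E_k`); at an expansion child of a PRESENT parent `graftAbove k (t ∘ init) tnew` with the laws assembled ACROSS FRAMES (`lawsT_towerOfTerms_crossFrame`: every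
old-level law but (O1) is inherited from the parent's `Sect2.LawsRT … k`); at an expansion child of an ABSENT parent `graftAbove k (dropBFrom k (t ∘ init)) (zeroRB tnew)` (old
`𝐁^{(k)}` and new `𝐑 ∕ 𝐁` zeroed — the child is absent, p580585, so its clause is the zero disjunct and NO law is owed by the supplier there; the universal `𝐄^{(k+1)}`'s four clauses
are transferred from any present-parent expansion child by p575321 §0, and if there is none the whole construction runs with `𝐄^{(k+1)} := 0`).  HENCE:
§1 ★★★ `sect3SupplyAt_of_spliceSupply` — `Sect3SpliceSupplyAt θ p k → Sect3SupplyAt θ p k` (`0 ≤ E₀, B₀` only).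
§2 re-keyed faces of p578897: (S1ᵀ) ∕ THEOREM 1 all levels on the live line (generic `θ`) · THEOREM 1 at the H-extensions of the witness of record from
   `NoExpansionTStepAt ∧ Sect3SpliceSupplyAt` per level and NOTHING ELSE · ★ at the re-pinned door of the cured witness of record, `ρ₁`'s §2 form for every history of length 1
   from `0 < K` + `Sect3SpliceSupplyAt … 0` ALONE — and at `k = 0` (O1) is VOID: the level-0 supply is EXACTLY Thm-2-type clauses for the first-step terms `𝐄^{(1)}, 𝐑^{(1)}, 𝐁^{(1)}`
   and the identity `𝐓ρ₀ = 𝐓₀ exp A₁` at the expansion pairs `(Ω₁ ≠ ∅, Λ₁)` ([I] Thm 1 + [II], the first small-field step, at the objects of record).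

HONEST FRAMING.  Count-neutral kernel bookkeeping; `Sect3SpliceSupplyAt` ([III] Sect. 1 ∕ §3 ∕ Thm 2 at the objects of record, plus (O1)) and `NoExpansionTStepAt` (dag-n11-d's
lane) are DISPLAYED, not proved; nothing of Bałaban asserted; N11 NOT discharged; K1⁷ NOT closed; counts unmoved (typed 28∕28 · discharged 5∕27).  One finite `𝕋⁴_{L^K}`
programme at fixed `ε = L^{−K}`; NOT ℝ⁴, NOT OS, NOT a mass gap, NOT Clay.
Sources: [III] Theorem p.245, Thm 1 p.262, Thm 2 p.263, §2 p.262, §3 p.279, (3.67) p.283, (3.24)–(3.25) p.270, (2.17)–(2.18) p.257, (2.23)–(2.31) pp.258–260, (2.34)–(2.42)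
p.261; [IV] (0.2)–(0.4) p.176, p.177 (i)–(ii); [Balaban1987RG1] (0.20) p.256.
-/

noncomputable section

open MeasureTheory
open scoped BigOperators Matrix.Norms.L2Operator

namespace Summit.QuantumFields.YangMills.Theorems.BalabanUVNodesN11Sect3SupplySplice

open Literature.MathematicalPhysics.QuantumFieldTheory.Balaban1983to89 T4Continuum Node00 Node00.Tk DagBinding
open Step B14.Eq227LocalizedTerms
open Literature.MathematicalPhysics.QuantumFieldTheory.Balaban1983to89.B16RLeafRecord13AtLive (B0_nonneg_theta13LiveOfFamily E0_nonneg_theta13LiveOfFamily)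
open BalabanUVNodesN11Sect3SupplyDefs (Sect3SupplyAt NoExpansionTStepAt)
open BalabanUVNodesN11Sect3SupplySpliceDefs
open BalabanUVNodesN11Sect3SupplySpliceFrame
open BalabanUVNodesN11Sect3SupplyPresentParents (slotsTOfRecord₁₃H_succ_eq_zero_of_init_eq_zero)
open BalabanUVNodesN11NoExpansionStepReductionRePinnedUnivECoPH (newEClauses_of_lawsT_of_eqE)
open BalabanUVNodesN11ThmP245OfSect3SupplyCoPH (sLaw₁₃CoPH_all_of_tStep_of_supply_of_liveSel sLaw₁₃CoPH_all_theta13LiveOfRecordH_of_tStep_of_supply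
  sLaw₁₃CoPH_one_rePinH_doorCured_theta13LiveOfRecord_of_sect3Supply_zero thmP245Laws_of_tStep_of_supply)
open BalabanUVNodesN11RePinnedParamDefs (rePinH)

variable {F : T4Family} {N : ℕ} [NeZero N]
variable (θ : Stage13HParams F N) (p : B12.RunParams)

/-! ## §0. The laws of the two expansion-child witnesses on the child's tower of record -/

section ChildLaws

/-- **THE 𝐓-IMAGE LAWS AT AN EXPANSION CHILD OF A PRESENT PARENT** for the spliced witness `graftAbove k tpar u`: from the parent's inductive assumptions for `tpar`
(`Sect2.LawsRT` on the tower at `init s′`), the level-`k` boundary term of `tpar` on the CHILD's `Ũ^c_k(X)` ((O1), void at `k = 0`), and r11's new-term obligations + analyticity at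
`k+1` for `u` on the child's tower ((O2)) — `…SpliceFrame.lawsT_towerOfTerms_crossFrame` at the record (`bgI ∕ bgMS` shared by `rfl`, `Ω_{≤ k}` by `seq_init_Ω_of_le`).
[cite: Balaban1988Convergent, §2 p.262, §3 p.279, (2.27)–(2.31) pp.259–260, (2.38)–(2.42) p.261] -/
theorem lawsT_child_graftAbove_of_rows {k : ℕ} (s : SeqOfRecord F θ.ν θ.τ9.M (gOfRecord₁₃ F N θ.toStage13Params p) p.K (k + 1))
    {tpar u : Sect2.TermValues (F.P p.K) (MatA N) (FluctV N) θ.τ9.M}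
    (hlaw : Sect2.LawsRT (sect2TowerOfRecord F N (FluctV N) p.K (settingOfRecord₁₃ F N θ.toStage13Params p) (θ.rzAt p s.init) s.init tpar)
      (settingOfRecord₁₃ F N θ.toStage13Params p).lf k)
    (hO1 : 1 ≤ k →
      (∀ (X : (Sect2.domSys (F.P p.K) θ.τ9.M k).Dom) (φ : Sect2.CPair (F.P p.K) (MatA N)) (a : SFluct (F.P p.K) (FluctV N)),
        φ ∈ (sect2TowerOfRecord F N (FluctV N) p.K (settingOfRecord₁₃ F N θ.toStage13Params p) (θ.rzAt p s) s tpar).spaceB k X →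
          ‖tpar.B k X φ a‖ ≤ (settingOfRecord₁₃ F N θ.toStage13Params p).lf.B₀ * Real.exp (-(settingOfRecord₁₃ F N θ.toStage13Params p).lf.κ * (Sect2.domSys (F.P p.K) θ.τ9.M k).dj X)) ∧
      (∀ (X : (Sect2.domSys (F.P p.K) θ.τ9.M k).Dom) (a : SFluct (F.P p.K) (FluctV N)),
        AnalyticOnNhd ℂ (fun φ => tpar.B k X φ a) ((sect2TowerOfRecord F N (FluctV N) p.K (settingOfRecord₁₃ F N θ.toStage13Params p) (θ.rzAt p s) s tpar).spaceB k X)))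
    (hO2 : Step.LFNewTerms (sect2TowerOfRecord F N (FluctV N) p.K (settingOfRecord₁₃ F N θ.toStage13Params p) (θ.rzAt p s) s u)
      (settingOfRecord₁₃ F N θ.toStage13Params p).lf (settingOfRecord₁₃ F N θ.toStage13Params p).βc k)
    (hanE : ∀ (X : (Sect2.domSys (F.P p.K) θ.τ9.M (k + 1)).Dom) (z : Site (F.P p.K) (k + 1)) (g : ℝ), 0 ≤ g → g ≤ (settingOfRecord₁₃ F N θ.toStage13Params p).lf.γ →
      AnalyticOnNhd ℂ (u.E (k + 1) X z g)
        ((sect2TowerOfRecord F N (FluctV N) p.K (settingOfRecord₁₃ F N θ.toStage13Params p) (θ.rzAt p s) s u).space (k + 1) X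
          ((settingOfRecord₁₃ F N θ.toStage13Params p).lf.alpha0 ((settingOfRecord₁₃ F N θ.toStage13Params p).flow.g (k + 1)))
          ((settingOfRecord₁₃ F N θ.toStage13Params p).lf.alpha1 ((settingOfRecord₁₃ F N θ.toStage13Params p).flow.g (k + 1)))))
    (hanR : ∀ X : (Sect2.domSys (F.P p.K) θ.τ9.M (k + 1)).Dom,
      AnalyticOnNhd ℂ (u.R (k + 1) X)
        ((sect2TowerOfRecord F N (FluctV N) p.K (settingOfRecord₁₃ F N θ.toStage13Params p) (θ.rzAt p s) s u).space (k + 1) X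
          ((settingOfRecord₁₃ F N θ.toStage13Params p).lf.alpha0 ((settingOfRecord₁₃ F N θ.toStage13Params p).flow.g (k + 1)))
          ((settingOfRecord₁₃ F N θ.toStage13Params p).lf.alpha1 ((settingOfRecord₁₃ F N θ.toStage13Params p).flow.g (k + 1)))))
    (hanB : ∀ (X : (Sect2.domSys (F.P p.K) θ.τ9.M (k + 1)).Dom) (a : SFluct (F.P p.K) (FluctV N)),
      AnalyticOnNhd ℂ (fun φ => u.B (k + 1) X φ a)
        ((sect2TowerOfRecord F N (FluctV N) p.K (settingOfRecord₁₃ F N θ.toStage13Params p) (θ.rzAt p s) s u).spaceB (k + 1) X)) :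
    Sect2.LawsT (sect2TowerOfRecord F N (FluctV N) p.K (settingOfRecord₁₃ F N θ.toStage13Params p) (θ.rzAt p s) s (graftAbove k tpar u))
      (settingOfRecord₁₃ F N θ.toStage13Params p).lf (settingOfRecord₁₃ F N θ.toStage13Params p).βc k := by
  refine lawsT_towerOfTerms_crossFrame (settingOfRecord₁₃ F N θ.toStage13Params p) (Rz := θ.rzAt p s.init) (Rz' := θ.rzAt p s) rfl rfl
    (Ω := s.init.Ω) (Ω' := s.Ω) (fun i hi => (seq_init_Ω_of_le s hi).symm)
    (fun j hj X z g φ => graftAbove_E_of_le tpar u hj X z g φ) (fun j hj X φ => graftAbove_R_of_le tpar u hj X φ)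
    (fun j hj X φ a => graftAbove_B_of_le tpar u hj.le X φ a) hlaw (fun h1 X φ a hφ => ?_) (fun h1 X a => ?_)
    (lfNewTerms_graftAbove _ _ _ hO2) (fun X z g hg0 hgγ => ?_) (fun X => ?_) (fun X a => ?_)
  · rw [graftAbove_B_of_le tpar u le_rfl]; exact (hO1 h1).1 X φ a hφ
  · rw [show (fun φ => (graftAbove k tpar u).B k X φ a) = fun φ => tpar.B k X φ a from funext fun φ => graftAbove_B_of_le tpar u le_rfl X φ a]
    exact (hO1 h1).2 X a
  · rw [graftAbove_E_succ]; exact hanE X z g hg0 hgγ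
  · rw [graftAbove_R_succ]; exact hanR X
  · rw [graftAbove_B_succ]; exact hanB X a

/-- **THE 𝐓-IMAGE LAWS AT AN EXPANSION CHILD OF AN ABSENT PARENT** for the witness `graftAbove k (dropBFrom k tpar) (zeroRB u)` (old `𝐄 ∕ 𝐑` and the old `𝐁^{(j)}`, `j < k`, of
`tpar`; `𝐁^{(k)} := 0`; the universal new `𝐄^{(k+1)}` of `u`; no new `𝐑 ∕ 𝐁`): from the parent's inductive assumptions for `tpar` and the FOUR level-`(k+1)` 𝐄-CLAUSES of the
witness on the child's tower (transferred from elsewhere by the caller) — the zeroed terms obey their laws by `0 ≤ B₀`, `0 ≤ g_{k+1}` and the RG equation of record.  NOTHING is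
owed by a supplier here. [cite: Balaban1988Convergent, §2 p.262, (3.25) p.270, (2.27)–(2.31) pp.259–260, (2.40)–(2.42) p.261; Balaban1987RG1, (0.20) p.256] -/
theorem lawsT_child_absent_of_newEClauses (hB₀ : 0 ≤ θ.s2.lf.B₀) {k : ℕ} (s : SeqOfRecord F θ.ν θ.τ9.M (gOfRecord₁₃ F N θ.toStage13Params p) p.K (k + 1))
    {tpar u : Sect2.TermValues (F.P p.K) (MatA N) (FluctV N) θ.τ9.M}
    (hlaw : Sect2.LawsRT (sect2TowerOfRecord F N (FluctV N) p.K (settingOfRecord₁₃ F N θ.toStage13Params p) (θ.rzAt p s.init) s.init tpar)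
      (settingOfRecord₁₃ F N θ.toStage13Params p).lf k)
    (hEcl :
      (∀ X z g φ ψ, (sect2TowerOfRecord F N (FluctV N) p.K (settingOfRecord₁₃ F N θ.toStage13Params p) (θ.rzAt p s) s (graftAbove k (dropBFrom k tpar) (zeroRB u))).agreeOn (k + 1) X φ ψ →
        (graftAbove k (dropBFrom k tpar) (zeroRB u)).E (k + 1) X z g φ = (graftAbove k (dropBFrom k tpar) (zeroRB u)).E (k + 1) X z g ψ) ∧
      (∀ X z g v φ, (graftAbove k (dropBFrom k tpar) (zeroRB u)).E (k + 1) X z g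
          ((sect2TowerOfRecord F N (FluctV N) p.K (settingOfRecord₁₃ F N θ.toStage13Params p) (θ.rzAt p s) s (graftAbove k (dropBFrom k tpar) (zeroRB u))).act v φ) =
        (graftAbove k (dropBFrom k tpar) (zeroRB u)).E (k + 1) X z g φ) ∧
      (∀ X z g φ, 0 ≤ g → g ≤ (settingOfRecord₁₃ F N θ.toStage13Params p).lf.γ →
        φ ∈ (sect2TowerOfRecord F N (FluctV N) p.K (settingOfRecord₁₃ F N θ.toStage13Params p) (θ.rzAt p s) s (graftAbove k (dropBFrom k tpar) (zeroRB u))).space (k + 1) X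
            ((settingOfRecord₁₃ F N θ.toStage13Params p).lf.alpha0 ((settingOfRecord₁₃ F N θ.toStage13Params p).flow.g (k + 1)))
            ((settingOfRecord₁₃ F N θ.toStage13Params p).lf.alpha1 ((settingOfRecord₁₃ F N θ.toStage13Params p).flow.g (k + 1))) →
          ‖(graftAbove k (dropBFrom k tpar) (zeroRB u)).E (k + 1) X z g φ‖ ≤
            (settingOfRecord₁₃ F N θ.toStage13Params p).lf.E₀ *
              Real.exp (-((1 + 4 * (settingOfRecord₁₃ F N θ.toStage13Params p).βc) * (settingOfRecord₁₃ F N θ.toStage13Params p).lf.κ) * (Sect2.domSys (F.P p.K) θ.τ9.M (k + 1)).dj X)) ∧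
      (∀ X z g, 0 ≤ g → g ≤ (settingOfRecord₁₃ F N θ.toStage13Params p).lf.γ →
        AnalyticOnNhd ℂ ((graftAbove k (dropBFrom k tpar) (zeroRB u)).E (k + 1) X z g)
          ((sect2TowerOfRecord F N (FluctV N) p.K (settingOfRecord₁₃ F N θ.toStage13Params p) (θ.rzAt p s) s (graftAbove k (dropBFrom k tpar) (zeroRB u))).space (k + 1) X
            ((settingOfRecord₁₃ F N θ.toStage13Params p).lf.alpha0 ((settingOfRecord₁₃ F N θ.toStage13Params p).flow.g (k + 1)))
            ((settingOfRecord₁₃ F N θ.toStage13Params p).lf.alpha1 ((settingOfRecord₁₃ F N θ.toStage13Params p).flow.g (k + 1)))))) :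
    Sect2.LawsT (sect2TowerOfRecord F N (FluctV N) p.K (settingOfRecord₁₃ F N θ.toStage13Params p) (θ.rzAt p s) s (graftAbove k (dropBFrom k tpar) (zeroRB u)))
      (settingOfRecord₁₃ F N θ.toStage13Params p).lf (settingOfRecord₁₃ F N θ.toStage13Params p).βc k := by
  obtain ⟨hlocE, hinvE, hbdE, hanE⟩ := hEcl
  have hlt := Nat.lt_succ_self k
  have hR' : ∀ X φ, (graftAbove k (dropBFrom k tpar) (zeroRB u)).R (k + 1) X φ = 0 := fun X φ => by
    rw [graftAbove_R_of_lt _ _ hlt]; rfl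
  have hB' : ∀ X φ a, (graftAbove k (dropBFrom k tpar) (zeroRB u)).B (k + 1) X φ a = 0 := fun X φ a => by
    rw [graftAbove_B_of_lt _ _ hlt]; rfl
  have hBk : ∀ X φ a, (graftAbove k (dropBFrom k tpar) (zeroRB u)).B k X φ a = 0 := fun X φ a => by
    rw [graftAbove_B_of_le _ _ le_rfl, dropBFrom_B_of_le _ le_rfl]
  refine lawsT_towerOfTerms_crossFrame (settingOfRecord₁₃ F N θ.toStage13Params p) (Rz := θ.rzAt p s.init) (Rz' := θ.rzAt p s) rfl rfl
    (Ω := s.init.Ω) (Ω' := s.Ω) (fun i hi => (seq_init_Ω_of_le s hi).symm) (t := tpar) (t' := graftAbove k (dropBFrom k tpar) (zeroRB u))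
    (fun j hj X z g φ => graftAbove_E_of_le (dropBFrom k tpar) (zeroRB u) hj X z g φ) (fun j hj X φ => graftAbove_R_of_le (dropBFrom k tpar) (zeroRB u) hj X φ)
    (fun j hj X φ a => ?_) hlaw (fun _ X φ a _ => ?_) (fun _ X a => ?_)
    (lfNewTerms_of_newE_of_noR_of_noB _ _ _ (settingOfRecord₁₃_satisfiesRG F N θ.toStage13Params p (k + 1) k hlt) hR' hB' hlocE hinvE hbdE hB₀
      (B16RLeafRecord13Live.gOfRecord₁₃_succ_nonneg F N θ.toStage13Params p k))
    hanE (fun X => analyticR_of_noR hR' X _) (fun X a => analyticB_of_noB hB' X a _)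
  · rw [graftAbove_B_of_le _ _ hj.le X φ a, dropBFrom_B_of_lt _ hj]
  · rw [hBk, norm_zero]; exact mul_nonneg hB₀ (Real.exp_nonneg _)
  · exact analyticB_of_noB (j := k) hBk X a _

/-- **AT LEVEL `k = 1` THE OBLIGATION (O1) IS THE PARENT'S INDUCTIVE ASSUMPTION** (LOCATED-SPACEB bites only from `k = 2` on): the child `s′` (length `2`) and its parent have
`Ω₀ = ∅` (off-window) and the same `Ω₁`, so `Ũ^c_1(X)` is the same space (`…SpliceFrame.towerOfTerms_spaceB_one_eq_of_agree`) and (2.42) ∕ (2.41)(ii) for the old `𝐁^{(1)}` on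
the child's tower ARE the clauses of `Sect2.LawsRT … 1` at the parent.  A supplier of `Sect3SpliceSupplyAt θ p 1` discharges (O1) by citing this with `(hS.2 (init s′)).1`.
[cite: Balaban1988Convergent, (2.38), (2.41)–(2.42) p.261, (2.1) p.254 (bookkeeping)] -/
theorem o1_one_of_lawsRT (s : SeqOfRecord F θ.ν θ.τ9.M (gOfRecord₁₃ F N θ.toStage13Params p) p.K (1 + 1))
    {tpar : Sect2.TermValues (F.P p.K) (MatA N) (FluctV N) θ.τ9.M}
    (hlaw : Sect2.LawsRT (sect2TowerOfRecord F N (FluctV N) p.K (settingOfRecord₁₃ F N θ.toStage13Params p) (θ.rzAt p s.init) s.init tpar)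
      (settingOfRecord₁₃ F N θ.toStage13Params p).lf 1) :
    (∀ (X : (Sect2.domSys (F.P p.K) θ.τ9.M 1).Dom) (φ : Sect2.CPair (F.P p.K) (MatA N)) (a : SFluct (F.P p.K) (FluctV N)),
      φ ∈ (sect2TowerOfRecord F N (FluctV N) p.K (settingOfRecord₁₃ F N θ.toStage13Params p) (θ.rzAt p s) s tpar).spaceB 1 X →
        ‖tpar.B 1 X φ a‖ ≤ (settingOfRecord₁₃ F N θ.toStage13Params p).lf.B₀ * Real.exp (-(settingOfRecord₁₃ F N θ.toStage13Params p).lf.κ * (Sect2.domSys (F.P p.K) θ.τ9.M 1).dj X)) ∧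
    (∀ (X : (Sect2.domSys (F.P p.K) θ.τ9.M 1).Dom) (a : SFluct (F.P p.K) (FluctV N)),
      AnalyticOnNhd ℂ (fun φ => tpar.B 1 X φ a) ((sect2TowerOfRecord F N (FluctV N) p.K (settingOfRecord₁₃ F N θ.toStage13Params p) (θ.rzAt p s) s tpar).spaceB 1 X)) := by
  have h0 : s.init.Ω 0 = ∅ := s.init.Ω_off 0 (fun h => Nat.not_succ_le_zero 0 h.1)
  have h0' : s.Ω 0 = ∅ := s.Ω_off 0 (fun h => Nat.not_succ_le_zero 0 h.1)
  have hsp : ∀ X : (Sect2.domSys (F.P p.K) θ.τ9.M 1).Dom,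
      (sect2TowerOfRecord F N (FluctV N) p.K (settingOfRecord₁₃ F N θ.toStage13Params p) (θ.rzAt p s) s tpar).spaceB 1 X =
        (sect2TowerOfRecord F N (FluctV N) p.K (settingOfRecord₁₃ F N θ.toStage13Params p) (θ.rzAt p s.init) s.init tpar).spaceB 1 X := fun X =>
    towerOfTerms_spaceB_one_eq_of_agree (settingOfRecord₁₃ F N θ.toStage13Params p) (Rz := θ.rzAt p s.init) (Rz' := θ.rzAt p s) rfl h0 h0'
      (seq_init_Ω_of_le s le_rfl).symm tpar tpar X
  obtain ⟨hH, hA⟩ := hlaw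
  refine ⟨fun X φ a hφ => ?_, fun X a => ?_⟩
  · rw [hsp] at hφ; exact hH.boundB 1 le_rfl le_rfl X φ a hφ
  · rw [hsp]; exact hA.analyticB 1 le_rfl le_rfl X a

end ChildLaws

/-! ## §1. The minimal supply gives the supply -/

section Main

/-- **★★★ `Sect3SpliceSupplyAt θ p k → Sect3SupplyAt θ p k`** (generic `θ : Stage13HParams`; `0 ≤ E₀, B₀` for the zeroed terms).  Given the exposed witness `(t, E_k)` and the
supplier's `(tnew, EkN)`: if SOME expansion child `s₁` has a present parent, the family is `graftAbove k (t ∘ init) (zeroRB tnew)` at the no-expansion histories,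
`graftAbove k (t ∘ init) tnew` at the expansion children of present parents (laws by §0 from (O1)∕(O2), clause (O3)), `graftAbove k (dropBFrom k (t ∘ init)) (zeroRB tnew)` at the
expansion children of absent parents (laws by §0 with the new-𝐄 clauses transferred from `s₁` — universality of `t` and `tnew`, p575321 §0 — clause by the zero disjunct,
p580585); constants `E_k ∘ init` resp. `EkN`.  If NONE has, the same with `𝐄^{(k+1)} := 0` (`Sect2.TermValues.zero` as the new source; the four clauses from `0 ≤ E₀`).
Universality of the family: every member's 𝐄 is `graftAbove`'s.  [cite: Balaban1988Convergent, Theorem p.245, §2 p.262, §3 p.279, (3.67) p.283, (3.24)–(3.25) p.270, (2.25)–(2.28) p.259, (2.40)–(2.42) p.261, (2.17)–(2.18) p.257] -/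
theorem sect3SupplyAt_of_spliceSupply {k : ℕ} (hE₀ : 0 ≤ θ.s2.lf.E₀) (hB₀ : 0 ≤ θ.s2.lf.B₀) (h : Sect3SpliceSupplyAt θ p k) :
    Sect3SupplyAt θ p k := by
  classical
  intro t Ek hS
  obtain ⟨hu, hs⟩ := hS
  obtain ⟨tnew, EkN, huN, hx⟩ := h t Ek ⟨hu, hs⟩
  -- an absent parent has an absent 𝐓-image child
  have hzero : ∀ s : SeqOfRecord F θ.ν θ.τ9.M (gOfRecord₁₃ F N θ.toStage13Params p) p.K (k + 1),
      slotsOfRecord F N θ.ν θ.τ9 (EOfRecord₁₃ F N θ.toStage13Params) (wOfRecord₉ F N θ.toStage9Params) θ.ppSel p (gOfRecord₁₃ F N θ.toStage13Params p) k s.init = 0 →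
      slotsTOfRecord F N θ.ν θ.τ9 (EOfRecord₁₃ F N θ.toStage13Params) (wOfRecord₉ F N θ.toStage9Params) θ.ppSel p (gOfRecord₁₃ F N θ.toStage13Params p) (k + 1) s = 0 :=
    fun s h0 => slotsTOfRecord₁₃H_succ_eq_zero_of_init_eq_zero θ p s h0
  -- the no-expansion bookkeeping of `graftAbove k (t ∘ init) (zeroRB v)` for any new source `v`
  have hbook : ∀ (s : SeqOfRecord F θ.ν θ.τ9.M (gOfRecord₁₃ F N θ.toStage13Params p) p.K (k + 1)) (v : Sect2.TermValues (F.P p.K) (MatA N) (FluctV N) θ.τ9.M),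
      (∀ j, j ≤ k → ∀ X z g φ, (graftAbove k (t s.init) (zeroRB v)).E j X z g φ = (t s.init).E j X z g φ) ∧
      (∀ j, j ≤ k → ∀ X φ, (graftAbove k (t s.init) (zeroRB v)).R j X φ = (t s.init).R j X φ) ∧
      (∀ j, j ≤ k → ∀ X φ a, (graftAbove k (t s.init) (zeroRB v)).B j X φ a = (t s.init).B j X φ a) ∧
      (∀ X φ, (graftAbove k (t s.init) (zeroRB v)).R (k + 1) X φ = 0) ∧ (∀ X φ a, (graftAbove k (t s.init) (zeroRB v)).B (k + 1) X φ a = 0) := fun s v =>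
    ⟨fun j hj X z g φ => graftAbove_E_of_le _ _ hj X z g φ, fun j hj X φ => graftAbove_R_of_le _ _ hj X φ, fun j hj X φ a => graftAbove_B_of_le _ _ hj X φ a,
      fun X φ => by rw [graftAbove_R_of_lt _ _ (Nat.lt_succ_self k)]; rfl, fun X φ a => by rw [graftAbove_B_of_lt _ _ (Nat.lt_succ_self k)]; rfl⟩
  by_cases hex : ∃ s₁ : SeqOfRecord F θ.ν θ.τ9.M (gOfRecord₁₃ F N θ.toStage13Params p) p.K (k + 1), s₁.Ω (k + 1) ≠ ∅ ∧
      slotsOfRecord F N θ.ν θ.τ9 (EOfRecord₁₃ F N θ.toStage13Params) (wOfRecord₉ F N θ.toStage9Params) θ.ppSel p (gOfRecord₁₃ F N θ.toStage13Params p) k s₁.init ≠ 0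
  · -- SOME expansion child has a present parent: the new 𝐄 is the supplier's
    obtain ⟨s₁, hs₁Ω, hs₁ρ⟩ := hex
    have hLpres : ∀ s : SeqOfRecord F θ.ν θ.τ9.M (gOfRecord₁₃ F N θ.toStage13Params p) p.K (k + 1), s.Ω (k + 1) ≠ ∅ →
        slotsOfRecord F N θ.ν θ.τ9 (EOfRecord₁₃ F N θ.toStage13Params) (wOfRecord₉ F N θ.toStage9Params) θ.ppSel p (gOfRecord₁₃ F N θ.toStage13Params p) k s.init ≠ 0 →
        Sect2.LawsT (sect2TowerOfRecord F N (FluctV N) p.K (settingOfRecord₁₃ F N θ.toStage13Params p) (θ.rzAt p s) s (graftAbove k (t s.init) (tnew s)))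
          (settingOfRecord₁₃ F N θ.toStage13Params p).lf (settingOfRecord₁₃ F N θ.toStage13Params p).βc k := fun s hsΩ hsρ =>
      lawsT_child_graftAbove_of_rows θ p s (hs s.init).1 (hx s hsΩ hsρ).1 (hx s hsΩ hsρ).2.1 (hx s hsΩ hsρ).2.2.1 (hx s hsΩ hsρ).2.2.2.1 (hx s hsΩ hsρ).2.2.2.2.1
    -- the family
    obtain ⟨tT, htT⟩ : ∃ tT : SeqOfRecord F θ.ν θ.τ9.M (gOfRecord₁₃ F N θ.toStage13Params p) p.K (k + 1) → Sect2.TermValues (F.P p.K) (MatA N) (FluctV N) θ.τ9.M,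
        ∀ s, tT s = if s.Ω (k + 1) = ∅ then graftAbove k (t s.init) (zeroRB (tnew s)) else
          if slotsOfRecord F N θ.ν θ.τ9 (EOfRecord₁₃ F N θ.toStage13Params) (wOfRecord₉ F N θ.toStage9Params) θ.ppSel p (gOfRecord₁₃ F N θ.toStage13Params p) k s.init = 0 then
            graftAbove k (dropBFrom k (t s.init)) (zeroRB (tnew s)) else graftAbove k (t s.init) (tnew s) := ⟨_, fun _ => rfl⟩
    obtain ⟨EkT, hEkT⟩ : ∃ EkT : SeqOfRecord F θ.ν θ.τ9.M (gOfRecord₁₃ F N θ.toStage13Params p) p.K (k + 1) → ℝ,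
        ∀ s, EkT s = if s.Ω (k + 1) = ∅ then Ek s.init else EkN s := ⟨_, fun _ => rfl⟩
    have hTE : ∀ s, (tT s).E = (graftAbove k (t s.init) (tnew s)).E := fun s => by
      rw [htT s]; split_ifs <;> rfl
    refine ⟨tT, EkT, universalE_graftAbove hu huN k (fun s => s.init) tT hTE, fun s hΩ => ?_, fun s hsΩ => ?_⟩
    · -- (ii) the no-expansion bookkeeping
      rw [htT s, if_pos hΩ]
      obtain ⟨h1, h2, h3, h4, h5⟩ := hbook s (tnew s)
      exact ⟨h1, h2, h3, h4, h5, by rw [hEkT s, if_pos hΩ]⟩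
    · -- (iii) at an expansion child
      by_cases hsρ : slotsOfRecord F N θ.ν θ.τ9 (EOfRecord₁₃ F N θ.toStage13Params) (wOfRecord₉ F N θ.toStage9Params) θ.ppSel p (gOfRecord₁₃ F N θ.toStage13Params p) k s.init = 0
      · -- absent parent: new 𝐄 transferred from `s₁`, everything else zero above `k` (and `𝐁^{(k)}`), clause by the zero disjunct
        rw [htT s, if_neg hsΩ, if_pos hsρ]
        refine ⟨lawsT_child_absent_of_newEClauses θ p hB₀ s (hs s.init).1 ?_, Or.inl (hzero s hsρ)⟩
        have hEE : (graftAbove k (dropBFrom k (t s.init)) (zeroRB (tnew s))).E = (graftAbove k (t s₁.init) (tnew s₁)).E := by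
          rw [graftAbove_E, graftAbove_E]
          funext j X z g φ
          show (if j ≤ k then (t s.init).E j X z g φ else (tnew s).E j X z g φ) = if j ≤ k then (t s₁.init).E j X z g φ else (tnew s₁).E j X z g φ
          rw [hu s.init s₁.init, huN s s₁]
        exact newEClauses_of_lawsT_of_eqE (settingOfRecord₁₃ F N θ.toStage13Params p) (Rz := θ.rzAt p s₁) (Rz' := θ.rzAt p s) rfl s₁.Ω s.Ω hEE (hLpres s₁ hs₁Ω hs₁ρ)
      · -- present parent: (O1) ∕ (O2) give the laws, (O3) the clause
        rw [htT s, if_neg hsΩ, if_neg hsρ]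
        refine ⟨hLpres s hsΩ hsρ, ?_⟩
        rw [hEkT s, if_neg hsΩ]
        exact (hx s hsΩ hsρ).2.2.2.2.2
  · -- NO expansion child has a present parent: run with `𝐄^{(k+1)} := 0`
    have habs : ∀ s : SeqOfRecord F θ.ν θ.τ9.M (gOfRecord₁₃ F N θ.toStage13Params p) p.K (k + 1), s.Ω (k + 1) ≠ ∅ →
        slotsOfRecord F N θ.ν θ.τ9 (EOfRecord₁₃ F N θ.toStage13Params) (wOfRecord₉ F N θ.toStage9Params) θ.ppSel p (gOfRecord₁₃ F N θ.toStage13Params p) k s.init = 0 :=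
      fun s hsΩ => by
        by_contra hne
        exact hex ⟨s, hsΩ, hne⟩
    obtain ⟨tT, htT⟩ : ∃ tT : SeqOfRecord F θ.ν θ.τ9.M (gOfRecord₁₃ F N θ.toStage13Params p) p.K (k + 1) → Sect2.TermValues (F.P p.K) (MatA N) (FluctV N) θ.τ9.M,
        ∀ s, tT s = if s.Ω (k + 1) = ∅ then graftAbove k (t s.init) (zeroRB Sect2.TermValues.zero) else
          graftAbove k (dropBFrom k (t s.init)) (zeroRB Sect2.TermValues.zero) := ⟨_, fun _ => rfl⟩
    have hTE : ∀ s, (tT s).E = (graftAbove k (t s.init) ((fun _ => (Sect2.TermValues.zero : Sect2.TermValues (F.P p.K) (MatA N) (FluctV N) θ.τ9.M)) s)).E := fun s => by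
      rw [htT s]; split_ifs <;> rfl
    refine ⟨tT, fun s => Ek s.init, universalE_graftAbove hu (Sect2.universalE_const _) k (fun s => s.init) tT hTE, fun s hΩ => ?_, fun s hsΩ => ?_⟩
    · rw [htT s, if_pos hΩ]
      obtain ⟨h1, h2, h3, h4, h5⟩ := hbook s Sect2.TermValues.zero
      exact ⟨h1, h2, h3, h4, h5, rfl⟩
    · rw [htT s, if_neg hsΩ]
      refine ⟨lawsT_child_absent_of_newEClauses θ p hB₀ s (hs s.init).1 ?_, Or.inl (hzero s (habs s hsΩ))⟩
      exact newEClauses_of_zeroE (settingOfRecord₁₃ F N θ.toStage13Params p) (θ.rzAt p s) s.Ω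
        (fun X z g φ => by rw [graftAbove_E_of_lt _ _ (Nat.lt_succ_self k)]; rfl) hE₀

end Main

/-! ## §2. Theorem 1 and the (S1ᵀ) slot re-keyed on the minimal supply -/

section Faces

/-- **(S1ᵀ) — `∀ k < K, SLaw₁₃CoPH θ p k → TLaw₁₃CoPH θ p k` — FROM `NoExpansionTStepAt` AND THE MINIMAL SUPPLY `Sect3SpliceSupplyAt` PER LEVEL**, generic `θ` (`1 ≤ M`,
`0 ≤ E₀, B₀`): p578897 §2 over §1. [cite: Balaban1988Convergent, Theorem p.245, Thm 1 p.262, Thm 2 p.263, §2 p.262, §3 p.279] -/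
theorem thmP245Laws_of_tStep_of_spliceSupply (hM : 1 ≤ θ.τ9.M) (hB₀ : 0 ≤ θ.s2.lf.B₀) (hE₀ : 0 ≤ θ.s2.lf.E₀)
    (hT : ∀ k, k < p.K → NoExpansionTStepAt θ p k) (hsup : ∀ k, k < p.K → Sect3SpliceSupplyAt θ p k) :
    ∀ k, k < p.K → SLaw₁₃CoPH F N θ p k → TLaw₁₃CoPH F N θ p k :=
  thmP245Laws_of_tStep_of_supply θ p hM hB₀ hE₀ hT fun k hk => sect3SupplyAt_of_spliceSupply θ p hE₀ hB₀ (hsup k hk)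

/-- **★★★ THEOREM 1 OF [III] AT `θ`, ALL LEVELS, ALL HISTORIES, ON THE LIVE-SELECTOR LINE — FROM `NoExpansionTStepAt` AND THE MINIMAL SUPPLY PER LEVEL** (row `rstep` of
`θ.Provisos₁₃CoPH`, the selector clause, admissibility, the signs, `1 ≤ M`): p578897 §2 over §1. [cite: Balaban1988Convergent, Thm 1 p.262, Theorem p.245, Thm 2 p.263, p.244, §3 p.279; Balaban1989LargeFieldI, (0.2)–(0.4) p.176, p.177 (i)–(ii)] -/
theorem sLaw₁₃CoPH_all_of_tStep_of_spliceSupply_of_liveSel (h : θ.Provisos₁₃CoPH F N)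
    (hsel : θ.ppSel = ppSelLiveOfRecord F N θ.ν θ.τ9 (EOfRecord₁₃ F N θ.toStage13Params) (wOfRecord₉ F N θ.toStage9Params))
    (hθ : θ.Admissible F N) (hκ : 0 ≤ θ.s2.lf.κ) (hE₀ : 0 ≤ θ.s2.lf.E₀) (hB₀ : 0 ≤ θ.s2.lf.B₀) (hM : 1 ≤ θ.τ9.M)
    (hT : ∀ k, k < p.K → NoExpansionTStepAt θ p k) (hsup : ∀ k, k < p.K → Sect3SpliceSupplyAt θ p k) :
    ∀ k, k ≤ p.K → SLaw₁₃CoPH F N θ p k :=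
  sLaw₁₃CoPH_all_of_tStep_of_supply_of_liveSel θ p h hsel hθ hκ hE₀ hB₀ hM hT fun k hk => sect3SupplyAt_of_spliceSupply θ p hE₀ hB₀ (hsup k hk)

variable (F N)

/-- **★★★ THEOREM 1 OF [III] AT ANY H-EXTENSION OF THE WITNESS OF RECORD, ALL LEVELS — FROM `NoExpansionTStepAt` AND THE MINIMAL SUPPLY PER LEVEL, NOTHING ELSE** (p578897 §5:
the 𝐑-side, `M = 1` and the signs are the family's). [cite: Balaban1988Convergent, Thm 1 p.262, Theorem p.245, Thm 2 p.263, p.244, §3 p.279; Balaban1989LargeFieldI, (0.3)–(0.4) p.176, p.177 (i)–(ii)] -/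
theorem sLaw₁₃CoPH_all_theta13LiveOfRecordH_of_tStep_of_spliceSupply
    (Zr : (q : B12.RunParams) → TkResidualW F N (FluctV N) q.K)
    (Zh : (q : B12.RunParams) → ℕ → (ℕ → Set (Site (F.P q.K) 0)) → (ℕ → Set (Site (F.P q.K) 0)) → TkResidualW F N (FluctV N) q.K)
    (Phih : (q : B12.RunParams) → ℕ → (ℕ → Set (Site (F.P q.K) 0)) → (ℕ → Set (Site (F.P q.K) 0)) → (ℕ → Plaq (F.P q.K) 0 → ℝ)) (p : B12.RunParams)
    (hT : ∀ k, k < p.K → NoExpansionTStepAt (⟨⟨theta13LiveOfRecord F N, Zr⟩, Zh, Phih⟩ : Stage13HParams F N) p k)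
    (hsup : ∀ k, k < p.K → Sect3SpliceSupplyAt (⟨⟨theta13LiveOfRecord F N, Zr⟩, Zh, Phih⟩ : Stage13HParams F N) p k) :
    ∀ k, k ≤ p.K → SLaw₁₃CoPH F N (⟨⟨theta13LiveOfRecord F N, Zr⟩, Zh, Phih⟩ : Stage13HParams F N) p k :=
  sLaw₁₃CoPH_all_theta13LiveOfRecordH_of_tStep_of_supply F N Zr Zh Phih p hT fun k hk =>
    sect3SupplyAt_of_spliceSupply _ p
      (E0_nonneg_theta13LiveOfFamily F N eps0OfRecord₁₃ (zeta316OfRecord F N (numerics7OfFamily eps0OfRecord₁₃) 1 1) (RzOfRecord F N) (ZtOfRecord F N))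
      (B0_nonneg_theta13LiveOfFamily F N eps0OfRecord₁₃ (zeta316OfRecord F N (numerics7OfFamily eps0OfRecord₁₃) 1 1) (RzOfRecord F N) (ZtOfRecord F N)) (hsup k hk)

/-- **★★★ `ρ₁`'s §2 FORM AT THE RE-PINNED DOOR OF THE CURED WITNESS OF RECORD, EVERY HISTORY OF LENGTH 1, FROM THE LEVEL-0 MINIMAL SUPPLY AND `0 < K` — NOTHING ELSE.**  At
`k = 0` the obligation (O1) is VOID (`1 ≤ 0` is false) and there are no old terms: `Sect3SpliceSupplyAt … p 0` asks, per exposed witness of `ρ₀`'s form and per expansion pair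
`(Ω₁ ≠ ∅, Λ₁)` with `ρ₀ ≢ 0`, EXACTLY for first-step terms `𝐄^{(1)}, 𝐑^{(1)}, 𝐁^{(1)}` obeying r11's new-term clauses ((2.27)(i)–(iii) with the improved bounds, (2.30)–(2.31),
(2.41)–(2.42), analyticity) and the identity `𝐓ρ₀ = 𝐓₀ exp A₁` a.e. on the support of `χ₁` — [I] Thm 1 + [II] at the objects of record; the no-expansion pair is p578897 §6's theorem.
[cite: Balaban1988Convergent, Thm 1 p.262, Theorem p.245, Thm 2 p.263, (3.24)–(3.25) p.270, §3 p.279; Balaban1989LargeFieldI, (0.3)–(0.4) p.176, p.177 (i)–(ii)] -/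
theorem sLaw₁₃CoPH_one_rePinH_doorCured_theta13LiveOfRecord_of_spliceSupply_zero (p : B12.RunParams) (hK : 0 < p.K)
    (hsup : Sect3SpliceSupplyAt (rePinH (Stage13HParams.ofHistoryBlind F N (Stage13RParams.ofCured F N (theta13LiveOfRecord F N)))) p 0) :
    SLaw₁₃CoPH F N (rePinH (Stage13HParams.ofHistoryBlind F N (Stage13RParams.ofCured F N (theta13LiveOfRecord F N)))) p 1 :=
  sLaw₁₃CoPH_one_rePinH_doorCured_theta13LiveOfRecord_of_sect3Supply_zero F N p hK
    (sect3SupplyAt_of_spliceSupply _ p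
      (E0_nonneg_theta13LiveOfFamily F N eps0OfRecord₁₃ (zeta316OfRecord F N (numerics7OfFamily eps0OfRecord₁₃) 1 1) (RzOfRecord F N) (ZtOfRecord F N))
      (B0_nonneg_theta13LiveOfFamily F N eps0OfRecord₁₃ (zeta316OfRecord F N (numerics7OfFamily eps0OfRecord₁₃) 1 1) (RzOfRecord F N) (ZtOfRecord F N)) hsup)

end Faces

end Summit.QuantumFields.YangMills.Theorems.BalabanUVNodesN11Sect3SupplySplice

end
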